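import Mathlib.LinearAlgebra.Matrix.Kronecker
import Mathlib.Analysis.Complex.Order
import Mathlib.Topology.Algebra.Module.FiniteDimension
import Literature.MathematicalPhysics.QuantumLattice.XYGriffithsBLU
import Literature.MathematicalPhysics.QuantumLattice.ProductOperators
import Literature.MathematicalPhysics.QuantumLattice.DuhamelTwoPoint
import HarnessLib

/-!
# Proof of Benassi–Lees–Ueltschi 2016, Corollary 2 (Griffiths–Ginibre monotonicity, spin-½ XY)

Discharges the named fact `benassiLeesUeltschi2016_cor2` of `XYGriffithsBLU.lean`
(`benassiLeesUeltschi2016_cor2_holds`, at the end of this file): for the spin-½ pair-plus-field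
XY Hamiltonian `xyPairFieldHamiltonian G K₀ K₁ h₀ h₁` with nonnegative couplings, raising the
direction-`0` couplings `K₀ ≤ K₀'` and fields `h₀ ≤ h₀'` does not lower `Re⟨Sˣ_x⟩_β` nor
`Re⟨Sˣ_x Sˣ_y⟩_β` — C. Benassi, B. Lees, D. Ueltschi, J. Stat. Phys. 164 (2016) 1157
= arXiv:1510.03215, Cor. 2 (first inequality), whose printed proof is Thm. 1 (positivity of
truncated Schwinger functions, §3: Ginibre's doubled system, Lemmas 6–8) + the Duhamel formula
`β⁻¹ ∂⟨·⟩/∂J = ∫₀¹ (⟨·;·⟩_s − ⟨·⟩⟨·⟩) ds`.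

## The proof formalised here (Ginibre's structure, integrated form)

We follow §3 of the paper but prove the INTEGRATED inequality directly, so that no derivative,
Duhamel two-point function or `s`-integral is needed:

* **Doubling** (`dbl`, `dblLeft = (· ⊗ 1)`, `dblRight = (1 ⊗ ·)`): `𝓗_Λ ⊗ 𝓗_Λ` is realised as the
  spin system `Op Λ 4` with four states per site (Kronecker product reindexed along
  `(Λ → Fin 2) × (Λ → Fin 2) ≃ (Λ → Fin 4)`), so that the single-site API of `SpinSystem.lean` /
  `ProductOperators.lean` (`onSite`, `productOp`, `productOp_conj_onSite`) applies to the doubled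
  system. `dblLeft`, `dblRight` are commuting continuous `ℂ`-algebra homomorphisms, hence
  `exp(A' ⊗ 1 + 1 ⊗ A) = exp A' ⊗ exp A` (`NormedSpace.map_exp`, `Matrix.exp_add_of_commute`) and
  **Ginibre's identity** (`trace_exp_mul_sub_eq_trace_dbl`, the two-Hamiltonian version of Lemma 6)
  `Tr(e^{A'}a)·Tr(e^{A}) − Tr(e^{A'})·Tr(e^{A}a) = Tr[e^{A'⊗1+1⊗A}(a ⊗ 1 − 1 ⊗ a)]`.
* **Lemma 7** (`two_smul_opPlus_mul`, `two_smul_opMinus_mul`): `2(ab)_± = a₊b_± + a₋b_∓` with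
  `a_± = a ⊗ 1 ± 1 ⊗ a` (`opPlus`, `opMinus`).
* **Lemma 8** in the tree's spin directions `(0, 1) = (x, y)` (the paper rotates to `(1, 3)`; we
  rotate its basis `p_±, q_±` back by `R ⊗ R`, `R = (1 + iσˣ)/√2`): the unitary `bluBasis` of
  `ℂ² ⊗ ℂ²` makes `(Sˣ)₊, (Sˣ)₋, (Sʸ)₊, −(Sʸ)₋` entrywise nonnegative (`entrywiseNonneg_plusX`, …,
  four `4 × 4` computations over `ℤ[i]`).
* **The cone** `IsPos M :⇔ U M Uᴴ` entrywise `≥ 0`, `U = ⨂_x bluBasisᴴ` (`productOp`): closed under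
  `+`, nonnegative scalars, `*`; `Tr ≥ 0` on it; contains `onSite x m` when `uᴴ m u ≥ 0`; and
  `Re Tr(e^X M) ≥ 0` for `X, M` in the cone (`IsPos.re_trace_exp_mul_nonneg`: Taylor partial sums
  of `exp`, `NormedSpace.exp_series_hasSum_exp'`, and a limit of nonnegative reals).
* **The exponent is in the cone** (`isPos_doubledExponent`): with `H' = H(K₀', h₀')`,
  `(−βH') ⊗ 1 + 1 ⊗ (−βH) = β Σ [K₀ (bond⁰)₊ + (K₀'−K₀)(bond⁰ ⊗ 1) + K₁ (bond¹)₊]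
  + β Σ [h₀ (Sˣ)₊ + (h₀'−h₀)(Sˣ ⊗ 1) + h₁ (Sʸ)₊]`, every bracket positive by Lemma 7; the paper's
  parity count ("the number of `S³₋` is always even") becomes the identity
  `(Sʸ_xSʸ_y)₊ = ½[(Sʸ_x)₊(Sʸ_y)₊ + (−(Sʸ_x)₋)(−(Sʸ_y)₋)]`. The observables `(Sˣ_x)₋` and
  `(Sˣ_xSˣ_y)₋ = ½[(Sˣ_x)₊(Sˣ_y)₋ + (Sˣ_x)₋(Sˣ_y)₊]` are positive too.
* **Assembly** (`re_gibbsState_le_of_isPos`): `Z, Z' > 0` are real (`H` Hermitian,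
  `IsHermitian.partitionFn_eq_ofReal`), so `Re⟨a⟩_{H'} − Re⟨a⟩_H = Re Tr[e^{…} a₋]/(Z Z') ≥ 0`.

Everything is proved; no new definition of `Prop` type (no named fact) is introduced.

## References

* C. Benassi, B. Lees, D. Ueltschi, *Correlation inequalities for the quantum XY model*,
  J. Stat. Phys. 164 (2016) 1157–1166 = arXiv:1510.03215, Thm. 1, Cor. 2, §3 Lemmas 6–8.
  [BenassiLeesUeltschi2016]
* J. Ginibre, *General formulation of Griffiths' inequalities*, Comm. Math. Phys. 16 (1970)
  310–328 (the doubled system and the cone axioms (Q1)–(Q3)). [Ginibre1970]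
-/

noncomputable section

open Matrix Complex NormedSpace Filter
open scoped Kronecker ComplexOrder Topology

namespace Literature.MathematicalPhysics.QuantumLattice

namespace GinibreXY

variable {Λ : Type*} [Fintype Λ] [DecidableEq Λ]

/-! ### The doubled system `𝓗_Λ ⊗ 𝓗_Λ` as a spin system with four states per site -/

/-- `Fin 2 × Fin 2 ≃ Fin 4`, `(a, b) ↦ 2a + b` (Mathlib's `finProdFinEquiv`). [folklore] -/
def finTwoProd : Fin 2 × Fin 2 ≃ Fin 4 := finProdFinEquiv

/-- The identification `(Λ → Fin 2) × (Λ → Fin 2) ≃ (Λ → Fin 4)` of a pair of spin-½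
configurations with a configuration of the doubled single-site space `ℂ² ⊗ ℂ² ≅ ℂ⁴`. [folklore] -/
def dblIndex : TensorIndex Λ 2 × TensorIndex Λ 2 ≃ TensorIndex Λ 4 where
  toFun p := fun x => finTwoProd (p.1 x, p.2 x)
  invFun σ := (fun x => (finTwoProd.symm (σ x)).1, fun x => (finTwoProd.symm (σ x)).2)
  left_inv p := by
    rcases p with ⟨σ, σ'⟩
    simp
  right_inv σ := by
    funext x
    simp

/-- The doubled operator `A ⊗ B` on `𝓗_Λ ⊗ 𝓗_Λ`, realised on `⨂_x ℂ⁴` (`Op Λ 4`): the Kronecker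
product reindexed along `dblIndex`. Benassi–Lees–Ueltschi (2016) §3 (product space), following
Ginibre (1970). [cite: BenassiLeesUeltschi2016, §3] -/
def dbl (A B : Op Λ 2) : Op Λ 4 :=
  Matrix.reindex dblIndex dblIndex (A ⊗ₖ B)

omit [Fintype Λ] [DecidableEq Λ] in
/-- Entries of `dbl A B`. [folklore] -/
theorem dbl_apply (A B : Op Λ 2) (σ τ : TensorIndex Λ 4) :
    dbl A B σ τ = A (dblIndex.symm σ).1 (dblIndex.symm τ).1 * B (dblIndex.symm σ).2 (dblIndex.symm τ).2 :=
  rfl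

/-- `(A ⊗ B)(A' ⊗ B') = AA' ⊗ BB'`. [folklore] -/
theorem dbl_mul (A B A' B' : Op Λ 2) : dbl (A * A') (B * B') = dbl A B * dbl A' B' := by
  unfold dbl
  rw [reindex_apply, reindex_apply, reindex_apply, mul_kronecker_mul,
    ← submatrix_mul_equiv (A ⊗ₖ B) (A' ⊗ₖ B') _ dblIndex.symm _]

omit [DecidableEq Λ] in
/-- `1 ⊗ 1 = 1`. [folklore] -/
@[simp] theorem dbl_one : dbl (1 : Op Λ 2) 1 = (1 : Op Λ 4) := by
  unfold dbl
  rw [one_kronecker_one, reindex_apply, submatrix_one_equiv]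

omit [Fintype Λ] [DecidableEq Λ] in
/-- Additivity in the left factor. [folklore] -/
theorem dbl_add_left (A A' B : Op Λ 2) : dbl (A + A') B = dbl A B + dbl A' B := by
  unfold dbl
  rw [add_kronecker, reindex_apply, reindex_apply, reindex_apply, submatrix_add]
  rfl

omit [Fintype Λ] [DecidableEq Λ] in
/-- Additivity in the right factor. [folklore] -/
theorem dbl_add_right (A B B' : Op Λ 2) : dbl A (B + B') = dbl A B + dbl A B' := by
  unfold dbl
  rw [kronecker_add, reindex_apply, reindex_apply, reindex_apply, submatrix_add]
  rfl

omit [Fintype Λ] [DecidableEq Λ] in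
/-- Homogeneity in the left factor. [folklore] -/
theorem dbl_smul_left (c : ℂ) (A B : Op Λ 2) : dbl (c • A) B = c • dbl A B := by
  unfold dbl
  rw [smul_kronecker, reindex_apply, reindex_apply, submatrix_smul]
  rfl

omit [Fintype Λ] [DecidableEq Λ] in
/-- Homogeneity in the right factor. [folklore] -/
theorem dbl_smul_right (c : ℂ) (A B : Op Λ 2) : dbl A (c • B) = c • dbl A B := by
  unfold dbl
  rw [kronecker_smul, reindex_apply, reindex_apply, submatrix_smul]
  rfl

omit [Fintype Λ] [DecidableEq Λ] in
/-- `0 ⊗ B = 0`. [folklore] -/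
@[simp] theorem dbl_zero_left (B : Op Λ 2) : dbl (0 : Op Λ 2) B = 0 := by
  unfold dbl
  rw [zero_kronecker, reindex_apply, submatrix_zero]
  rfl

omit [Fintype Λ] [DecidableEq Λ] in
/-- `A ⊗ 0 = 0`. [folklore] -/
@[simp] theorem dbl_zero_right (A : Op Λ 2) : dbl A (0 : Op Λ 2) = 0 := by
  unfold dbl
  rw [kronecker_zero, reindex_apply, submatrix_zero]
  rfl

/-- `Tr (A ⊗ B) = Tr A · Tr B`. [folklore] -/
theorem trace_dbl (A B : Op Λ 2) : (dbl A B).trace = A.trace * B.trace := by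
  rw [← trace_kronecker]
  unfold dbl
  simp only [Matrix.trace, reindex_apply, diag_apply, submatrix_apply]
  exact Fintype.sum_equiv dblIndex.symm _ _ fun _ => rfl

/-- The left embedding `A ↦ A ⊗ 1` as a `ℂ`-algebra homomorphism `𝔄_Λ → 𝔄_Λ ⊗ 𝔄_Λ`.
Benassi–Lees–Ueltschi (2016) §3. [cite: BenassiLeesUeltschi2016, §3] -/
def dblLeft : Op Λ 2 →ₐ[ℂ] Op Λ 4 where
  toFun A := dbl A 1
  map_one' := dbl_one
  map_mul' A A' := by
    rw [← dbl_mul, mul_one]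
  map_zero' := dbl_zero_left 1
  map_add' A A' := dbl_add_left A A' 1
  commutes' c := by
    rw [Algebra.algebraMap_eq_smul_one, Algebra.algebraMap_eq_smul_one, dbl_smul_left, dbl_one]

/-- The right embedding `B ↦ 1 ⊗ B` as a `ℂ`-algebra homomorphism. [cite: BenassiLeesUeltschi2016, §3] -/
def dblRight : Op Λ 2 →ₐ[ℂ] Op Λ 4 where
  toFun B := dbl 1 B
  map_one' := dbl_one
  map_mul' B B' := by
    rw [← dbl_mul, mul_one]
  map_zero' := dbl_zero_right 1
  map_add' B B' := dbl_add_right 1 B B'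
  commutes' c := by
    rw [Algebra.algebraMap_eq_smul_one, Algebra.algebraMap_eq_smul_one, dbl_smul_right, dbl_one]

/-- Unfolding `dblLeft`. [folklore] -/
theorem dblLeft_apply (A : Op Λ 2) : dblLeft A = dbl A 1 := rfl

/-- Unfolding `dblRight`. [folklore] -/
theorem dblRight_apply (B : Op Λ 2) : dblRight B = dbl 1 B := rfl

/-- `(A ⊗ 1)(1 ⊗ B) = A ⊗ B`. [folklore] -/
theorem dblLeft_mul_dblRight (A B : Op Λ 2) : dblLeft A * dblRight B = dbl A B := by
  rw [dblLeft_apply, dblRight_apply, ← dbl_mul, mul_one, one_mul]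

/-- `(1 ⊗ B)(A ⊗ 1) = A ⊗ B`. [folklore] -/
theorem dblRight_mul_dblLeft (A B : Op Λ 2) : dblRight B * dblLeft A = dbl A B := by
  rw [dblLeft_apply, dblRight_apply, ← dbl_mul, mul_one, one_mul]

/-- The two embeddings commute: `[A ⊗ 1, 1 ⊗ B] = 0`. [folklore] -/
theorem commute_dblLeft_dblRight (A B : Op Λ 2) : Commute (dblLeft A) (dblRight B) := by
  rw [Commute, SemiconjBy, dblLeft_mul_dblRight, dblRight_mul_dblLeft]

section Continuity

open scoped Matrix.Norms.L2Operator

/-- `A ↦ A ⊗ 1` is continuous (a linear map between finite-dimensional spaces). [folklore] -/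
theorem continuous_dblLeft : Continuous (dblLeft : Op Λ 2 → Op Λ 4) :=
  (dblLeft : Op Λ 2 →ₐ[ℂ] Op Λ 4).toLinearMap.continuous_of_finiteDimensional

/-- `B ↦ 1 ⊗ B` is continuous. [folklore] -/
theorem continuous_dblRight : Continuous (dblRight : Op Λ 2 → Op Λ 4) :=
  (dblRight : Op Λ 2 →ₐ[ℂ] Op Λ 4).toLinearMap.continuous_of_finiteDimensional

/-- `exp (A ⊗ 1) = exp A ⊗ 1` (continuous algebra homomorphisms commute with `exp`). [folklore] -/
theorem dblLeft_exp (A : Op Λ 2) : dblLeft (exp A) = exp (dblLeft A) := by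
  letI : NormedAlgebra ℚ (Op Λ 2) := NormedAlgebra.restrictScalars ℚ ℂ (Op Λ 2)
  exact map_exp (dblLeft : Op Λ 2 →ₐ[ℂ] Op Λ 4) continuous_dblLeft A

/-- `exp (1 ⊗ B) = 1 ⊗ exp B`. [folklore] -/
theorem dblRight_exp (B : Op Λ 2) : dblRight (exp B) = exp (dblRight B) := by
  letI : NormedAlgebra ℚ (Op Λ 2) := NormedAlgebra.restrictScalars ℚ ℂ (Op Λ 2)
  exact map_exp (dblRight : Op Λ 2 →ₐ[ℂ] Op Λ 4) continuous_dblRight B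

/-- `exp (A ⊗ 1 + 1 ⊗ B) = exp A ⊗ exp B`. Benassi–Lees–Ueltschi (2016) §3 (`e^{-H_{Λ,+}}`).
[cite: BenassiLeesUeltschi2016, §3] -/
theorem exp_dblLeft_add_dblRight (A B : Op Λ 2) :
    exp (dblLeft A + dblRight B) = dbl (exp A) (exp B) := by
  rw [Matrix.exp_add_of_commute _ _ (commute_dblLeft_dblRight A B), ← dblLeft_exp, ← dblRight_exp,
    dblLeft_mul_dblRight]

end Continuity

/-- **Ginibre's identity for the difference of two Gibbs expectations**:
`Tr(e^{A'} a) · Tr(e^{A}) − Tr(e^{A'}) · Tr(e^{A} a) = Tr_{𝓗⊗𝓗}[e^{A' ⊗ 1 + 1 ⊗ A} (a ⊗ 1 − 1 ⊗ a)]`.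
Benassi–Lees–Ueltschi (2016) §3, Lemma 6 (first line, with two different Hamiltonians).
[cite: BenassiLeesUeltschi2016, Lemma 6] -/
theorem trace_exp_mul_sub_eq_trace_dbl (A A' a : Op Λ 2) :
    (exp A' * a).trace * (exp A).trace - (exp A').trace * (exp A * a).trace =
      (exp (dblLeft A' + dblRight A) * (dblLeft a - dblRight a)).trace := by
  rw [exp_dblLeft_add_dblRight, mul_sub, trace_sub, ← dblLeft_mul_dblRight, mul_assoc,
    ← (commute_dblLeft_dblRight a (exp A)).eq, ← mul_assoc, ← map_mul, dblLeft_mul_dblRight,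
    trace_dbl, mul_assoc, ← map_mul, dblLeft_mul_dblRight, trace_dbl]


/-! ### Entrywise-nonnegative complex matrices -/

section Entrywise

variable {n : Type*} [Fintype n] [DecidableEq n]

/-- A complex square matrix is entrywise nonnegative (`0 ≤ A i j` in the order of `ℂ`, i.e. every
entry is a nonnegative real). Benassi–Lees–Ueltschi (2016) Lemma 8 ("nonnegative matrix
elements"). [folklore] -/
def EntrywiseNonneg (A : Matrix n n ℂ) : Prop :=
  ∀ i j, 0 ≤ A i j

omit [Fintype n] [DecidableEq n] in
/-- Sums of entrywise-nonnegative matrices are entrywise nonnegative. [folklore] -/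
theorem EntrywiseNonneg.add {A B : Matrix n n ℂ} (hA : EntrywiseNonneg A) (hB : EntrywiseNonneg B) :
    EntrywiseNonneg (A + B) := fun i j => by
  rw [Matrix.add_apply]
  exact add_nonneg (hA i j) (hB i j)

omit [Fintype n] [DecidableEq n] in
/-- Nonnegative multiples of entrywise-nonnegative matrices are entrywise nonnegative. [folklore] -/
theorem EntrywiseNonneg.smul {A : Matrix n n ℂ} (hA : EntrywiseNonneg A) {c : ℂ} (hc : 0 ≤ c) :
    EntrywiseNonneg (c • A) := fun i j => by
  rw [Matrix.smul_apply, smul_eq_mul]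
  exact mul_nonneg hc (hA i j)

omit [DecidableEq n] in
/-- Products of entrywise-nonnegative matrices are entrywise nonnegative. [folklore] -/
theorem EntrywiseNonneg.mul {A B : Matrix n n ℂ} (hA : EntrywiseNonneg A) (hB : EntrywiseNonneg B) :
    EntrywiseNonneg (A * B) := fun i j => by
  rw [Matrix.mul_apply]
  exact Finset.sum_nonneg fun k _ => mul_nonneg (hA i k) (hB k j)

omit [Fintype n] in
/-- The identity matrix is entrywise nonnegative. [folklore] -/
theorem EntrywiseNonneg.one : EntrywiseNonneg (1 : Matrix n n ℂ) := fun i j => by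
  rw [Matrix.one_apply]
  split_ifs
  · exact zero_le_one
  · exact le_rfl

omit [DecidableEq n] in
/-- An entrywise-nonnegative matrix has nonnegative (real) trace. [folklore] -/
theorem EntrywiseNonneg.trace_nonneg {A : Matrix n n ℂ} (hA : EntrywiseNonneg A) : 0 ≤ A.trace :=
  Finset.sum_nonneg fun i _ => hA i i

end Entrywise

/-! ### The basis of Lemma 8, transported to the spin directions `(Sˣ, Sʸ)` -/

/-- `√2` times the unitary whose COLUMNS are the basis of Benassi–Lees–Ueltschi (2016) Lemma 8,
rotated from the paper's spin directions `(1, 3)` to the tree's `(0, 1) = (x, y)` by `R ⊗ R`,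
`R = (1 + iσˣ)/√2` (`R σᶻ R⋆ = σʸ`): in the product basis `|00⟩, |01⟩, |10⟩, |11⟩` of `ℂ² ⊗ ℂ²`
(`0` = spin up) the columns are `i(|01⟩ + |10⟩)`, `|00⟩ − |11⟩`, `i(|00⟩ + |11⟩)`, `|10⟩ − |01⟩`.
[cite: BenassiLeesUeltschi2016, Lemma 8] -/
def bluBasis₀ : Matrix (Fin 4) (Fin 4) ℂ :=
  !![0, 1, I, 0; I, 0, 0, -1; I, 0, 0, 1; 0, -1, I, 0]

/-- The conjugate transpose of `bluBasis₀`, written out. [cite: BenassiLeesUeltschi2016, Lemma 8] -/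
def bluBasis₀Star : Matrix (Fin 4) (Fin 4) ℂ :=
  !![0, -I, -I, 0; 1, 0, 0, -1; -I, 0, 0, -I; 0, -1, 1, 0]

/-- `bluBasis₀ᴴ = bluBasis₀Star`. [folklore] -/
theorem conjTranspose_bluBasis₀ : bluBasis₀ᴴ = bluBasis₀Star := by
  ext i j
  fin_cases i <;> fin_cases j <;> simp [bluBasis₀, bluBasis₀Star, conjTranspose_apply]

/-- The columns of `bluBasis₀` are orthogonal of squared norm `2`: `bluBasis₀ᴴ bluBasis₀ = 2`.
[cite: BenassiLeesUeltschi2016, Lemma 8] -/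
theorem bluBasis₀Star_mul_bluBasis₀ : bluBasis₀Star * bluBasis₀ = (2 : ℂ) • (1 : Matrix (Fin 4) (Fin 4) ℂ) := by
  ext i j
  fin_cases i <;> fin_cases j <;>
    simp [bluBasis₀, bluBasis₀Star, Matrix.mul_apply, Fin.sum_univ_four] <;> ring

/-- `bluBasis₀ bluBasis₀ᴴ = 2`. [cite: BenassiLeesUeltschi2016, Lemma 8] -/
theorem bluBasis₀_mul_bluBasis₀Star : bluBasis₀ * bluBasis₀Star = (2 : ℂ) • (1 : Matrix (Fin 4) (Fin 4) ℂ) := by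
  ext i j
  fin_cases i <;> fin_cases j <;>
    simp [bluBasis₀, bluBasis₀Star, Matrix.mul_apply, Fin.sum_univ_four] <;> ring

/-- The unitary `u = bluBasis₀ / √2` whose columns are the (rotated) orthonormal basis of
Benassi–Lees–Ueltschi (2016) Lemma 8. [cite: BenassiLeesUeltschi2016, Lemma 8] -/
def bluBasis : Matrix (Fin 4) (Fin 4) ℂ :=
  ((Real.sqrt 2 : ℝ) : ℂ)⁻¹ • bluBasis₀

/-- `(1/√2)⋆ (1/√2) · 2 = 1` in `ℂ`. [folklore] -/
theorem star_invSqrtTwo_mul : star (((Real.sqrt 2 : ℝ) : ℂ)⁻¹) * ((Real.sqrt 2 : ℝ) : ℂ)⁻¹ * 2 = 1 := by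
  have h2 : ((Real.sqrt 2 : ℝ) : ℂ) * ((Real.sqrt 2 : ℝ) : ℂ) = 2 := by
    rw [← ofReal_mul, Real.mul_self_sqrt (by norm_num : (0 : ℝ) ≤ 2)]
    norm_num
  have hne : ((Real.sqrt 2 : ℝ) : ℂ) ≠ 0 := by
    rw [Ne, ofReal_eq_zero]
    exact (Real.sqrt_pos.mpr (by norm_num : (0 : ℝ) < 2)).ne'
  rw [star_inv₀, Complex.star_def, conj_ofReal, ← h2]
  field_simp

/-- `bluBasis` is unitary: `uᴴ u = 1`. [cite: BenassiLeesUeltschi2016, Lemma 8] -/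
theorem conjTranspose_bluBasis_mul : bluBasisᴴ * bluBasis = 1 := by
  rw [bluBasis, conjTranspose_smul, conjTranspose_bluBasis₀, Matrix.smul_mul, Matrix.mul_smul,
    bluBasis₀Star_mul_bluBasis₀, smul_smul, smul_smul, star_invSqrtTwo_mul, one_smul]

/-- `bluBasis` is unitary: `u uᴴ = 1`. [cite: BenassiLeesUeltschi2016, Lemma 8] -/
theorem bluBasis_mul_conjTranspose : bluBasis * bluBasisᴴ = 1 := by
  rw [bluBasis, conjTranspose_smul, conjTranspose_bluBasis₀, Matrix.smul_mul, Matrix.mul_smul,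
    bluBasis₀_mul_bluBasis₀Star, smul_smul, smul_smul, mul_comm (((Real.sqrt 2 : ℝ) : ℂ)⁻¹) (star _),
    star_invSqrtTwo_mul, one_smul]

/-- Conjugation by `bluBasis` versus by `bluBasis₀`: `uᴴ m u = ((1/√2)⋆(1/√2)) • (bluBasis₀ᴴ m bluBasis₀)`.
[folklore] -/
theorem conjTranspose_bluBasis_mul_mul (m : Matrix (Fin 4) (Fin 4) ℂ) :
    bluBasisᴴ * m * bluBasis =
      (star (((Real.sqrt 2 : ℝ) : ℂ)⁻¹) * ((Real.sqrt 2 : ℝ) : ℂ)⁻¹) • (bluBasis₀Star * m * bluBasis₀) := by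
  rw [bluBasis, conjTranspose_smul, conjTranspose_bluBasis₀, Matrix.smul_mul, Matrix.smul_mul,
    Matrix.mul_smul, smul_smul]

/-- The scalar `(1/√2)⋆ (1/√2) = 1/2` is nonnegative. [folklore] -/
theorem star_invSqrtTwo_mul_nonneg : (0 : ℂ) ≤ star (((Real.sqrt 2 : ℝ) : ℂ)⁻¹) * ((Real.sqrt 2 : ℝ) : ℂ)⁻¹ := by
  rw [star_inv₀, Complex.star_def, conj_ofReal, ← ofReal_inv, ← ofReal_mul]
  exact zero_le_real.mpr (mul_self_nonneg _)

/-! ### The Ginibre cone of the doubled spin-½ system -/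

/-- The analysing unitary `U = ⨂_x uᴴ` of the doubled system (`u = bluBasis`). [cite: BenassiLeesUeltschi2016, Lemma 8] -/
def bluU : Op Λ 4 :=
  productOp fun _ : Λ => bluBasisᴴ

/-- **The Ginibre cone**: an operator `M` on `𝓗_Λ ⊗ 𝓗_Λ` is *positive* when its matrix in the
product basis built from Lemma 8 is entrywise nonnegative, i.e. `U M Uᴴ` is entrywise
nonnegative. Benassi–Lees–Ueltschi (2016) §3 (proof of Thm. 1: "the trace of a polynomial, with
positive coefficients, of matrices with nonnegative elements"). [cite: BenassiLeesUeltschi2016, §3] -/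
def IsPos (M : Op Λ 4) : Prop :=
  EntrywiseNonneg (bluU * M * bluUᴴ)

/-- `U Uᴴ = 1`. [folklore] -/
theorem bluU_mul_conjTranspose : (bluU : Op Λ 4) * bluUᴴ = 1 :=
  productOp_mul_conjTranspose fun _ => by
    rw [conjTranspose_conjTranspose, conjTranspose_bluBasis_mul]

/-- `Uᴴ U = 1`. [folklore] -/
theorem conjTranspose_bluU_mul : (bluU : Op Λ 4)ᴴ * bluU = 1 :=
  productOp_conjTranspose_mul fun _ => by
    rw [conjTranspose_conjTranspose, bluBasis_mul_conjTranspose]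

/-- The cone is closed under addition. [folklore] -/
theorem IsPos.add {M N : Op Λ 4} (hM : IsPos M) (hN : IsPos N) : IsPos (M + N) := by
  unfold IsPos at *
  rw [Matrix.mul_add, Matrix.add_mul]
  exact hM.add hN

/-- The cone is closed under multiplication by nonnegative scalars. [folklore] -/
theorem IsPos.smul {M : Op Λ 4} (hM : IsPos M) {c : ℂ} (hc : 0 ≤ c) : IsPos (c • M) := by
  unfold IsPos at *
  rw [Matrix.mul_smul, Matrix.smul_mul]
  exact EntrywiseNonneg.smul hM hc

/-- The cone is closed under multiplication by nonnegative real scalars. [folklore] -/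
theorem IsPos.smul_real {M : Op Λ 4} (hM : IsPos M) {r : ℝ} (hr : 0 ≤ r) : IsPos ((r : ℂ) • M) :=
  hM.smul (zero_le_real.mpr hr)

/-- The cone is closed under products (`U (MN) Uᴴ = (U M Uᴴ)(U N Uᴴ)`). Benassi–Lees–Ueltschi
(2016) §3. [cite: BenassiLeesUeltschi2016, §3] -/
theorem IsPos.mul {M N : Op Λ 4} (hM : IsPos M) (hN : IsPos N) : IsPos (M * N) := by
  unfold IsPos at *
  rw [bluU, productOp_conj_mul (fun _ => by rw [conjTranspose_conjTranspose, bluBasis_mul_conjTranspose])]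
  exact hM.mul hN

/-- `1` lies in the cone. [folklore] -/
theorem IsPos.one : IsPos (1 : Op Λ 4) := by
  unfold IsPos
  rw [Matrix.mul_one, bluU_mul_conjTranspose]
  exact EntrywiseNonneg.one

/-- `0` lies in the cone. [folklore] -/
theorem IsPos.zero : IsPos (0 : Op Λ 4) := by
  unfold IsPos
  rw [Matrix.mul_zero, Matrix.zero_mul]
  exact fun _ _ => le_rfl

/-- The cone is closed under powers. [folklore] -/
theorem IsPos.pow {M : Op Λ 4} (hM : IsPos M) (k : ℕ) : IsPos (M ^ k) := by
  induction k with
  | zero => simpa using IsPos.one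
  | succ k ih => rw [pow_succ]; exact ih.mul hM

/-- The cone is closed under finite sums. [folklore] -/
theorem IsPos.sum {ι : Type*} (s : Finset ι) {f : ι → Op Λ 4} (hf : ∀ i ∈ s, IsPos (f i)) :
    IsPos (∑ i ∈ s, f i) := by
  classical
  induction s using Finset.induction_on with
  | empty => simpa using IsPos.zero
  | insert a s ha ih =>
    rw [Finset.sum_insert ha]
    exact (hf a (Finset.mem_insert_self a s)).add (ih fun i hi => hf i (Finset.mem_insert_of_mem hi))

/-- **Positivity of the trace on the cone**: `Tr M = Tr (U M Uᴴ) ≥ 0`. Benassi–Lees–Ueltschi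
(2016) §3 ("This is positive."). [cite: BenassiLeesUeltschi2016, §3] -/
theorem IsPos.trace_nonneg {M : Op Λ 4} (hM : IsPos M) : 0 ≤ M.trace := by
  have h : M.trace = (bluU * M * bluUᴴ).trace := by
    rw [trace_mul_cycle, conjTranspose_bluU_mul, Matrix.one_mul]
  rw [h]
  exact EntrywiseNonneg.trace_nonneg hM

/-- **Single-site generators of the cone**: if `uᴴ m u` is entrywise nonnegative then the
single-site operator `onSite x m` of the doubled system is positive
(`U (onSite x m) Uᴴ = onSite x (uᴴ m u)`). Benassi–Lees–Ueltschi (2016) Lemma 8 ("As a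
consequence, there exists an orthonormal basis of `𝓗_Λ ⊗ 𝓗_Λ` such that …").
[cite: BenassiLeesUeltschi2016, Lemma 8] -/
theorem isPos_onSite (x : Λ) {m : Matrix (Fin 4) (Fin 4) ℂ}
    (hm : EntrywiseNonneg (bluBasisᴴ * m * bluBasis)) : IsPos (onSite x m : Op Λ 4) := by
  unfold IsPos
  rw [bluU, productOp_conj_onSite (fun _ => by rw [conjTranspose_conjTranspose, conjTranspose_bluBasis_mul]),
    conjTranspose_conjTranspose]
  intro σ τ
  rw [onSite_apply]
  split_ifs
  · exact hm _ _
  · exact le_rfl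

/-- **Positivity of `Tr (e^X M)` on the cone**: expand `e^X = Σ Xᵏ/k!`; every partial sum
`Σ_{k<N} Tr(Xᵏ M)/k!` is `≥ 0`, and the limit of the real parts is `Re Tr(e^X M)`.
Benassi–Lees–Ueltschi (2016) §3 (proof of Thm. 1: "we expand the exponentials in Taylor
series, so as to get a positive linear combination of [traces]"). [cite: BenassiLeesUeltschi2016, §3] -/
theorem IsPos.re_trace_exp_mul_nonneg {X M : Op Λ 4} (hX : IsPos X) (hM : IsPos M) :
    0 ≤ ((exp X * M).trace).re := by
  have hsum : HasSum (fun k : ℕ => ((k.factorial : ℂ)⁻¹) • X ^ k) (exp X) := by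
    open scoped Matrix.Norms.L2Operator in exact exp_series_hasSum_exp' (𝕂 := ℂ) X
  have htend := hsum.tendsto_sum_nat
  have hcont : Continuous fun A : Op Λ 4 => ((A * M).trace).re :=
    Complex.continuous_re.comp ((continuous_id.matrix_mul continuous_const).matrix_trace)
  have hlim := (hcont.tendsto (exp X)).comp htend
  refine ge_of_tendsto' hlim fun N => ?_
  simp only [Function.comp_apply]
  rw [Finset.sum_mul, trace_sum, Complex.re_sum]
  refine Finset.sum_nonneg fun k _ => ?_
  rw [Matrix.smul_mul, trace_smul, smul_eq_mul]
  have hk : ((k.factorial : ℂ)⁻¹) = (((k.factorial : ℝ)⁻¹ : ℝ) : ℂ) := by push_cast; rfl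
  rw [hk, re_ofReal_mul]
  exact mul_nonneg (inv_nonneg.mpr (Nat.cast_nonneg _))
    (Complex.nonneg_iff.mp ((hX.pow k).mul hM).trace_nonneg).1


/-! ### Doubled single-site operators -/

/-- The single-site doubled matrix `a ⊗ b` on `ℂ² ⊗ ℂ² ≅ ℂ⁴` (Kronecker product reindexed by
`finTwoProd`). [folklore] -/
def pairMat (a b : Matrix (Fin 2) (Fin 2) ℂ) : Matrix (Fin 4) (Fin 4) ℂ :=
  Matrix.reindex finTwoProd finTwoProd (a ⊗ₖ b)

/-- Entries of `pairMat a b` on product indices. [folklore] -/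
theorem pairMat_apply (a b : Matrix (Fin 2) (Fin 2) ℂ) (i i' j j' : Fin 2) :
    pairMat a b (finTwoProd (i, i')) (finTwoProd (j, j')) = a i j * b i' j' := by
  simp [pairMat]

/-- `pairMat` is additive in the left factor. [folklore] -/
theorem pairMat_add_left (a a' b : Matrix (Fin 2) (Fin 2) ℂ) : pairMat (a + a') b = pairMat a b + pairMat a' b := by
  unfold pairMat
  rw [add_kronecker, reindex_apply, reindex_apply, reindex_apply, submatrix_add]
  rfl

/-- `pairMat` is additive in the right factor. [folklore] -/
theorem pairMat_add_right (a b b' : Matrix (Fin 2) (Fin 2) ℂ) : pairMat a (b + b') = pairMat a b + pairMat a b' := by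
  unfold pairMat
  rw [kronecker_add, reindex_apply, reindex_apply, reindex_apply, submatrix_add]
  rfl

/-- `pairMat` is homogeneous in the left factor. [folklore] -/
theorem pairMat_smul_left (c : ℂ) (a b : Matrix (Fin 2) (Fin 2) ℂ) : pairMat (c • a) b = c • pairMat a b := by
  unfold pairMat
  rw [smul_kronecker, reindex_apply, reindex_apply, submatrix_smul]
  rfl

/-- `pairMat` is homogeneous in the right factor. [folklore] -/
theorem pairMat_smul_right (c : ℂ) (a b : Matrix (Fin 2) (Fin 2) ℂ) : pairMat a (c • b) = c • pairMat a b := by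
  unfold pairMat
  rw [kronecker_smul, reindex_apply, reindex_apply, submatrix_smul]
  rfl

/-- **Doubling is local**: `(onSite x a) ⊗ (onSite x b) = onSite x (a ⊗ b)` in the doubled system.
[folklore] -/
theorem dbl_onSite (x : Λ) (a b : Matrix (Fin 2) (Fin 2) ℂ) :
    dbl (onSite x a) (onSite x b) = (onSite x (pairMat a b) : Op Λ 4) := by
  ext σ τ
  rw [dbl_apply, onSite_apply, onSite_apply, onSite_apply]
  have hpair : pairMat a b (σ x) (τ x) =
      a (finTwoProd.symm (σ x)).1 (finTwoProd.symm (τ x)).1 *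
        b (finTwoProd.symm (σ x)).2 (finTwoProd.symm (τ x)).2 := rfl
  have h1 : ∀ y, (dblIndex.symm σ).1 y = (finTwoProd.symm (σ y)).1 := fun _ => rfl
  have h2 : ∀ y, (dblIndex.symm σ).2 y = (finTwoProd.symm (σ y)).2 := fun _ => rfl
  have h1' : ∀ y, (dblIndex.symm τ).1 y = (finTwoProd.symm (τ y)).1 := fun _ => rfl
  have h2' : ∀ y, (dblIndex.symm τ).2 y = (finTwoProd.symm (τ y)).2 := fun _ => rfl
  simp only [h1, h2, h1', h2', hpair]
  by_cases h : ∀ y, y ≠ x → σ y = τ y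
  · rw [if_pos h, if_pos (fun y hy => by rw [h y hy]), if_pos (fun y hy => by rw [h y hy])]
  · rw [if_neg h]
    push Not at h
    obtain ⟨y, hy, hne⟩ := h
    have hor : (finTwoProd.symm (σ y)).1 ≠ (finTwoProd.symm (τ y)).1 ∨
        (finTwoProd.symm (σ y)).2 ≠ (finTwoProd.symm (τ y)).2 := by
      by_contra hc
      push Not at hc
      exact hne (finTwoProd.symm.injective (Prod.ext hc.1 hc.2))
    rcases hor with hne1 | hne2
    · rw [if_neg (show ¬ ∀ z, z ≠ x → (finTwoProd.symm (σ z)).1 = (finTwoProd.symm (τ z)).1 from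
        fun hall => hne1 (hall y hy)), zero_mul]
    · rw [if_neg (show ¬ ∀ z, z ≠ x → (finTwoProd.symm (σ z)).2 = (finTwoProd.symm (τ z)).2 from
        fun hall => hne2 (hall y hy)), mul_zero]

/-- `(onSite x a) ⊗ 1 = onSite x (a ⊗ 1)`. [folklore] -/
theorem dblLeft_onSite (x : Λ) (a : Matrix (Fin 2) (Fin 2) ℂ) :
    dblLeft (onSite x a) = (onSite x (pairMat a 1) : Op Λ 4) := by
  rw [dblLeft_apply, ← onSite_one' x, dbl_onSite]

/-- `1 ⊗ (onSite x b) = onSite x (1 ⊗ b)`. [folklore] -/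
theorem dblRight_onSite (x : Λ) (b : Matrix (Fin 2) (Fin 2) ℂ) :
    dblRight (onSite x b) = (onSite x (pairMat 1 b) : Op Λ 4) := by
  rw [dblRight_apply, ← onSite_one' x, dbl_onSite]

/-! ### Ginibre's `a₊ = a ⊗ 1 + 1 ⊗ a` and `a₋ = a ⊗ 1 − 1 ⊗ a` (Lemma 7) -/

/-- `a₊ = a ⊗ 1 + 1 ⊗ a`. Benassi–Lees–Ueltschi (2016) §3, eq. before Lemma 6. [cite: BenassiLeesUeltschi2016, §3] -/
def opPlus (A : Op Λ 2) : Op Λ 4 :=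
  dblLeft A + dblRight A

/-- `a₋ = a ⊗ 1 − 1 ⊗ a`. Benassi–Lees–Ueltschi (2016) §3, eq. before Lemma 6. [cite: BenassiLeesUeltschi2016, §3] -/
def opMinus (A : Op Λ 2) : Op Λ 4 :=
  dblLeft A - dblRight A

/-- `(a + b)₊ = a₊ + b₊`. [folklore] -/
theorem opPlus_add (A B : Op Λ 2) : opPlus (A + B) = opPlus A + opPlus B := by
  unfold opPlus; rw [map_add, map_add]; abel

/-- `(a + b)₋ = a₋ + b₋`. [folklore] -/
theorem opMinus_add (A B : Op Λ 2) : opMinus (A + B) = opMinus A + opMinus B := by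
  unfold opMinus; rw [map_add, map_add]; abel

/-- `(c a)₊ = c a₊`. [folklore] -/
theorem opPlus_smul (c : ℂ) (A : Op Λ 2) : opPlus (c • A) = c • opPlus A := by
  unfold opPlus; rw [map_smul, map_smul, smul_add]

/-- `(c a)₋ = c a₋`. [folklore] -/
theorem opMinus_smul (c : ℂ) (A : Op Λ 2) : opMinus (c • A) = c • opMinus A := by
  unfold opMinus; rw [map_smul, map_smul, smul_sub]

/-- `2 (a ⊗ 1) = a₊ + a₋`. [folklore] -/
theorem two_smul_dblLeft (A : Op Λ 2) : (2 : ℂ) • dblLeft A = opPlus A + opMinus A := by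
  unfold opPlus opMinus; rw [two_smul]; abel

/-- `2 (1 ⊗ a) = a₊ − a₋`. [folklore] -/
theorem two_smul_dblRight (A : Op Λ 2) : (2 : ℂ) • dblRight A = opPlus A - opMinus A := by
  unfold opPlus opMinus; rw [two_smul]; abel

/-- **Lemma 7, `+` case**: `2 (ab)₊ = a₊ b₊ + a₋ b₋`. Benassi–Lees–Ueltschi (2016) Lemma 7.
[cite: BenassiLeesUeltschi2016, Lemma 7] -/
theorem two_smul_opPlus_mul (A B : Op Λ 2) :
    (2 : ℂ) • opPlus (A * B) = opPlus A * opPlus B + opMinus A * opMinus B := by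
  unfold opPlus opMinus
  rw [map_mul, map_mul, two_smul]
  noncomm_ring

/-- **Lemma 7, `−` case**: `2 (ab)₋ = a₊ b₋ + a₋ b₊`. Benassi–Lees–Ueltschi (2016) Lemma 7.
[cite: BenassiLeesUeltschi2016, Lemma 7] -/
theorem two_smul_opMinus_mul (A B : Op Λ 2) :
    (2 : ℂ) • opMinus (A * B) = opPlus A * opMinus B + opMinus A * opPlus B := by
  unfold opPlus opMinus
  rw [map_mul, map_mul, two_smul]
  noncomm_ring

/-- `(0 : ℂ) ≤ 1/2`. [folklore] -/
theorem half_nonneg : (0 : ℂ) ≤ 2⁻¹ := by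
  rw [show (2⁻¹ : ℂ) = ((2⁻¹ : ℝ) : ℂ) by push_cast; rfl]
  exact zero_le_real.mpr (by norm_num)

/-- Halving inside the cone: if `2M` is positive then so is `M`. [folklore] -/
theorem IsPos.of_two_smul {M : Op Λ 4} (h : IsPos ((2 : ℂ) • M)) : IsPos M := by
  have h' := h.smul half_nonneg
  rwa [smul_smul, inv_mul_cancel₀ (two_ne_zero' ℂ), one_smul] at h'

/-- `a ⊗ 1` is positive when `a₊` and `a₋` are. Benassi–Lees–Ueltschi (2016) §3. [cite: BenassiLeesUeltschi2016, §3] -/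
theorem isPos_dblLeft {A : Op Λ 2} (hP : IsPos (opPlus A)) (hM : IsPos (opMinus A)) : IsPos (dblLeft A) :=
  IsPos.of_two_smul (by rw [two_smul_dblLeft]; exact hP.add hM)

/-- `(ab)₊` is positive when `a₊, b₊` and the product `a₋ b₋` are (Lemma 7: "both terms of the right
side have positive factors"). [cite: BenassiLeesUeltschi2016, Lemma 7] -/
theorem isPos_opPlus_mul {A B : Op Λ 2} (hA : IsPos (opPlus A)) (hB : IsPos (opPlus B))
    (hAB : IsPos (opMinus A * opMinus B)) : IsPos (opPlus (A * B)) :=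
  IsPos.of_two_smul (by rw [two_smul_opPlus_mul]; exact (hA.mul hB).add hAB)

/-- `(ab)₋` is positive when `a₊, a₋, b₊, b₋` are. [cite: BenassiLeesUeltschi2016, Lemma 7] -/
theorem isPos_opMinus_mul {A B : Op Λ 2} (hA : IsPos (opPlus A)) (hA' : IsPos (opMinus A))
    (hB : IsPos (opPlus B)) (hB' : IsPos (opMinus B)) : IsPos (opMinus (A * B)) :=
  IsPos.of_two_smul (by rw [two_smul_opMinus_mul]; exact (hA.mul hB').add (hA'.mul hB))

/-! ### Lemma 8: the four single-site generators are positive -/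

/-- `σˣ ⊗ 1 + 1 ⊗ σˣ` on `ℂ² ⊗ ℂ²`, written out. [cite: BenassiLeesUeltschi2016, Lemma 8] -/
def plusX : Matrix (Fin 4) (Fin 4) ℂ := !![0, 1, 1, 0; 1, 0, 0, 1; 1, 0, 0, 1; 0, 1, 1, 0]

/-- `σˣ ⊗ 1 − 1 ⊗ σˣ`, written out. [cite: BenassiLeesUeltschi2016, Lemma 8] -/
def minusX : Matrix (Fin 4) (Fin 4) ℂ := !![0, -1, 1, 0; -1, 0, 0, 1; 1, 0, 0, -1; 0, 1, -1, 0]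

/-- `σʸ ⊗ 1 + 1 ⊗ σʸ`, written out. [cite: BenassiLeesUeltschi2016, Lemma 8] -/
def plusY : Matrix (Fin 4) (Fin 4) ℂ := !![0, -I, -I, 0; I, 0, 0, -I; I, 0, 0, -I; 0, I, I, 0]

/-- `−(σʸ ⊗ 1 − 1 ⊗ σʸ)`, written out. [cite: BenassiLeesUeltschi2016, Lemma 8] -/
def negMinusY : Matrix (Fin 4) (Fin 4) ℂ := !![0, -I, I, 0; I, 0, 0, I; -I, 0, 0, -I; 0, -I, I, 0]

/-- Values of `finTwoProd`. [folklore] -/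
theorem finTwoProd_values :
    finTwoProd (0, 0) = 0 ∧ finTwoProd (0, 1) = 1 ∧ finTwoProd (1, 0) = 2 ∧ finTwoProd (1, 1) = 3 := by
  refine ⟨?_, ?_, ?_, ?_⟩ <;> decide

/-- Two `4 × 4` matrices agree iff they agree on product indices. [folklore] -/
theorem ext_finTwoProd {M N : Matrix (Fin 4) (Fin 4) ℂ}
    (h : ∀ i i' j j' : Fin 2, M (finTwoProd (i, i')) (finTwoProd (j, j')) = N (finTwoProd (i, i')) (finTwoProd (j, j'))) :
    M = N := by
  ext p q
  obtain ⟨⟨i, i'⟩, rfl⟩ := finTwoProd.surjective p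
  obtain ⟨⟨j, j'⟩, rfl⟩ := finTwoProd.surjective q
  exact h i i' j j'

/-- `σˣ ⊗ 1 + 1 ⊗ σˣ = plusX`. [folklore] -/
theorem pairMat_pauliX_plus : pairMat (spinHalfPauli 0) 1 + pairMat 1 (spinHalfPauli 0) = plusX := by
  obtain ⟨h00, h01, h10, h11⟩ := finTwoProd_values
  refine ext_finTwoProd fun i i' j j' => ?_
  rw [Matrix.add_apply, pairMat_apply, pairMat_apply]
  fin_cases i <;> fin_cases i' <;> fin_cases j <;> fin_cases j' <;>
    simp [h00, h01, h10, h11, spinHalfPauli, plusX]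

/-- `σˣ ⊗ 1 − 1 ⊗ σˣ = minusX`. [folklore] -/
theorem pairMat_pauliX_minus : pairMat (spinHalfPauli 0) 1 - pairMat 1 (spinHalfPauli 0) = minusX := by
  obtain ⟨h00, h01, h10, h11⟩ := finTwoProd_values
  refine ext_finTwoProd fun i i' j j' => ?_
  rw [Matrix.sub_apply, pairMat_apply, pairMat_apply]
  fin_cases i <;> fin_cases i' <;> fin_cases j <;> fin_cases j' <;>
    simp [h00, h01, h10, h11, spinHalfPauli, minusX]

/-- `σʸ ⊗ 1 + 1 ⊗ σʸ = plusY`. [folklore] -/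
theorem pairMat_pauliY_plus : pairMat (spinHalfPauli 1) 1 + pairMat 1 (spinHalfPauli 1) = plusY := by
  obtain ⟨h00, h01, h10, h11⟩ := finTwoProd_values
  refine ext_finTwoProd fun i i' j j' => ?_
  rw [Matrix.add_apply, pairMat_apply, pairMat_apply]
  fin_cases i <;> fin_cases i' <;> fin_cases j <;> fin_cases j' <;>
    simp [h00, h01, h10, h11, spinHalfPauli, plusY]

/-- `−(σʸ ⊗ 1 − 1 ⊗ σʸ) = negMinusY`. [folklore] -/
theorem pairMat_pauliY_negMinus : -(pairMat (spinHalfPauli 1) 1 - pairMat 1 (spinHalfPauli 1)) = negMinusY := by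
  obtain ⟨h00, h01, h10, h11⟩ := finTwoProd_values
  refine ext_finTwoProd fun i i' j j' => ?_
  rw [Matrix.neg_apply, Matrix.sub_apply, pairMat_apply, pairMat_apply]
  fin_cases i <;> fin_cases i' <;> fin_cases j <;> fin_cases j' <;>
    simp [h00, h01, h10, h11, spinHalfPauli, negMinusY]

/-- **Lemma 8 (i)**: `S¹₊` has nonnegative matrix elements in the basis. [cite: BenassiLeesUeltschi2016, Lemma 8] -/
theorem entrywiseNonneg_plusX : EntrywiseNonneg (bluBasis₀Star * plusX * bluBasis₀) := by
  intro i j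
  fin_cases i <;> fin_cases j <;>
    simp [bluBasis₀, bluBasis₀Star, plusX, Matrix.mul_apply, Fin.sum_univ_four] <;> ring_nf <;> norm_num [I_sq]

/-- **Lemma 8 (ii)**: `S¹₋` has nonnegative matrix elements in the basis. [cite: BenassiLeesUeltschi2016, Lemma 8] -/
theorem entrywiseNonneg_minusX : EntrywiseNonneg (bluBasis₀Star * minusX * bluBasis₀) := by
  intro i j
  fin_cases i <;> fin_cases j <;>
    simp [bluBasis₀, bluBasis₀Star, minusX, Matrix.mul_apply, Fin.sum_univ_four] <;> ring_nf <;> norm_num [I_sq]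

/-- **Lemma 8 (iii)**: `S³₊` (here `Sʸ₊`) has nonnegative matrix elements in the basis.
[cite: BenassiLeesUeltschi2016, Lemma 8] -/
theorem entrywiseNonneg_plusY : EntrywiseNonneg (bluBasis₀Star * plusY * bluBasis₀) := by
  intro i j
  fin_cases i <;> fin_cases j <;>
    simp [bluBasis₀, bluBasis₀Star, plusY, Matrix.mul_apply, Fin.sum_univ_four] <;> ring_nf <;> norm_num [I_sq]

/-- **Lemma 8 (iv)**: `−S³₋` (here `−Sʸ₋`) has nonnegative matrix elements in the basis.
[cite: BenassiLeesUeltschi2016, Lemma 8] -/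
theorem entrywiseNonneg_negMinusY : EntrywiseNonneg (bluBasis₀Star * negMinusY * bluBasis₀) := by
  intro i j
  fin_cases i <;> fin_cases j <;>
    simp [bluBasis₀, bluBasis₀Star, negMinusY, Matrix.mul_apply, Fin.sum_univ_four] <;> ring_nf <;> norm_num [I_sq]


/-- `(0 : ℂ) ≤ 1/2`. [folklore] -/
theorem one_half_nonneg : (0 : ℂ) ≤ 1 / 2 := by
  rw [one_div]; exact half_nonneg

/-- `(S^α_x)₊ = onSite x (½ (σ^α ⊗ 1 + 1 ⊗ σ^α))` for spin ½. [cite: BenassiLeesUeltschi2016, §3] -/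
theorem opPlus_siteSpin (x : Λ) (α : Fin 3) :
    opPlus (siteSpin 1 x α) =
      (onSite x ((1 / 2 : ℂ) • (pairMat (spinHalfPauli α) 1 + pairMat 1 (spinHalfPauli α))) : Op Λ 4) := by
  unfold opPlus siteSpin
  rw [spinVec_one_eq_half_spinHalfPauli, dblLeft_onSite, dblRight_onSite, pairMat_smul_left,
    pairMat_smul_right, ← onSite_add', ← smul_add]

/-- `(S^α_x)₋ = onSite x (½ (σ^α ⊗ 1 − 1 ⊗ σ^α))` for spin ½. [cite: BenassiLeesUeltschi2016, §3] -/
theorem opMinus_siteSpin (x : Λ) (α : Fin 3) :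
    opMinus (siteSpin 1 x α) =
      (onSite x ((1 / 2 : ℂ) • (pairMat (spinHalfPauli α) 1 - pairMat 1 (spinHalfPauli α))) : Op Λ 4) := by
  unfold opMinus siteSpin
  rw [spinVec_one_eq_half_spinHalfPauli, dblLeft_onSite, dblRight_onSite, pairMat_smul_left,
    pairMat_smul_right, ← onSite_sub', ← smul_sub]

/-- A single-site operator `onSite x (m/2)` is positive when `bluBasis₀ᴴ m bluBasis₀` is entrywise
nonnegative. [cite: BenassiLeesUeltschi2016, Lemma 8] -/
theorem isPos_onSite_half_smul (x : Λ) {m : Matrix (Fin 4) (Fin 4) ℂ}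
    (hm : EntrywiseNonneg (bluBasis₀Star * m * bluBasis₀)) :
    IsPos (onSite x ((1 / 2 : ℂ) • m) : Op Λ 4) := by
  refine isPos_onSite x ?_
  rw [conjTranspose_bluBasis_mul_mul, Matrix.mul_smul, Matrix.smul_mul, smul_smul]
  exact hm.smul (mul_nonneg star_invSqrtTwo_mul_nonneg one_half_nonneg)

/-- **`(Sˣ_x)₊` is positive.** [cite: BenassiLeesUeltschi2016, Lemma 8] -/
theorem isPos_opPlus_siteSpin_zero (x : Λ) : IsPos (opPlus (siteSpin 1 x 0) : Op Λ 4) := by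
  rw [opPlus_siteSpin, pairMat_pauliX_plus]
  exact isPos_onSite_half_smul x entrywiseNonneg_plusX

/-- **`(Sˣ_x)₋` is positive.** [cite: BenassiLeesUeltschi2016, Lemma 8] -/
theorem isPos_opMinus_siteSpin_zero (x : Λ) : IsPos (opMinus (siteSpin 1 x 0) : Op Λ 4) := by
  rw [opMinus_siteSpin, pairMat_pauliX_minus]
  exact isPos_onSite_half_smul x entrywiseNonneg_minusX

/-- **`(Sʸ_x)₊` is positive.** [cite: BenassiLeesUeltschi2016, Lemma 8] -/
theorem isPos_opPlus_siteSpin_one (x : Λ) : IsPos (opPlus (siteSpin 1 x 1) : Op Λ 4) := by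
  rw [opPlus_siteSpin, pairMat_pauliY_plus]
  exact isPos_onSite_half_smul x entrywiseNonneg_plusY

/-- **`−(Sʸ_x)₋` is positive.** [cite: BenassiLeesUeltschi2016, Lemma 8] -/
theorem isPos_neg_opMinus_siteSpin_one (x : Λ) : IsPos (-opMinus (siteSpin 1 x 1) : Op Λ 4) := by
  rw [opMinus_siteSpin, ← onSite_neg', ← smul_neg, pairMat_pauliY_negMinus]
  exact isPos_onSite_half_smul x entrywiseNonneg_negMinusY

/-! ### Positivity of the doubled Hamiltonian and of the observables -/

/-- `Sˣ_x ⊗ 1 = ½((Sˣ_x)₊ + (Sˣ_x)₋)` is positive. [cite: BenassiLeesUeltschi2016, §3] -/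
theorem isPos_dblLeft_siteSpin_zero (x : Λ) : IsPos (dblLeft (siteSpin 1 x 0) : Op Λ 4) :=
  isPos_dblLeft (isPos_opPlus_siteSpin_zero x) (isPos_opMinus_siteSpin_zero x)

/-- `(Sˣ_x Sˣ_y)₊` is positive. [cite: BenassiLeesUeltschi2016, §3] -/
theorem isPos_opPlus_siteSpin_mul_zero (x y : Λ) :
    IsPos (opPlus (siteSpin 1 x 0 * siteSpin 1 y 0) : Op Λ 4) :=
  isPos_opPlus_mul (isPos_opPlus_siteSpin_zero x) (isPos_opPlus_siteSpin_zero y)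
    ((isPos_opMinus_siteSpin_zero x).mul (isPos_opMinus_siteSpin_zero y))

/-- `(Sʸ_x Sʸ_y)₊ = ½((Sʸ_x)₊(Sʸ_y)₊ + (−(Sʸ_x)₋)(−(Sʸ_y)₋))` is positive: the `Sʸ₋` come in pairs
(the paper's parity count "the total number of operators `S³_{x,−}` is always even").
[cite: BenassiLeesUeltschi2016, §3] -/
theorem isPos_opPlus_siteSpin_mul_one (x y : Λ) :
    IsPos (opPlus (siteSpin 1 x 1 * siteSpin 1 y 1) : Op Λ 4) :=
  isPos_opPlus_mul (isPos_opPlus_siteSpin_one x) (isPos_opPlus_siteSpin_one y)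
    (by rw [← neg_mul_neg]; exact (isPos_neg_opMinus_siteSpin_one x).mul (isPos_neg_opMinus_siteSpin_one y))

/-- `(Sˣ_x Sˣ_y)₋` is positive (the observable of the two-point inequality).
[cite: BenassiLeesUeltschi2016, §3] -/
theorem isPos_opMinus_siteSpin_mul_zero (x y : Λ) :
    IsPos (opMinus (siteSpin 1 x 0 * siteSpin 1 y 0) : Op Λ 4) :=
  isPos_opMinus_mul (isPos_opPlus_siteSpin_zero x) (isPos_opMinus_siteSpin_zero x)
    (isPos_opPlus_siteSpin_zero y) (isPos_opMinus_siteSpin_zero y)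

/-- `(Sˣ_x Sˣ_y) ⊗ 1` is positive. [cite: BenassiLeesUeltschi2016, §3] -/
theorem isPos_dblLeft_siteSpin_mul_zero (x y : Λ) :
    IsPos (dblLeft (siteSpin 1 x 0 * siteSpin 1 y 0) : Op Λ 4) := by
  rw [map_mul]
  exact (isPos_dblLeft_siteSpin_zero x).mul (isPos_dblLeft_siteSpin_zero y)

/-- `(bond⁰_{xy})₊` is positive (`bond = ½(S_xS_y + S_yS_x)`). [cite: BenassiLeesUeltschi2016, §3] -/
theorem isPos_opPlus_spinBond_zero (x y : Λ) : IsPos (opPlus (spinBond 1 0 x y) : Op Λ 4) := by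
  rw [spinBond, opPlus_smul, opPlus_add]
  exact ((isPos_opPlus_siteSpin_mul_zero x y).add (isPos_opPlus_siteSpin_mul_zero y x)).smul one_half_nonneg

/-- `(bond¹_{xy})₊` is positive. [cite: BenassiLeesUeltschi2016, §3] -/
theorem isPos_opPlus_spinBond_one (x y : Λ) : IsPos (opPlus (spinBond 1 1 x y) : Op Λ 4) := by
  rw [spinBond, opPlus_smul, opPlus_add]
  exact ((isPos_opPlus_siteSpin_mul_one x y).add (isPos_opPlus_siteSpin_mul_one y x)).smul one_half_nonneg

/-- `bond⁰_{xy} ⊗ 1` is positive. [cite: BenassiLeesUeltschi2016, §3] -/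
theorem isPos_dblLeft_spinBond_zero (x y : Λ) : IsPos (dblLeft (spinBond 1 0 x y) : Op Λ 4) := by
  rw [spinBond, map_smul, map_add]
  exact ((isPos_dblLeft_siteSpin_mul_zero x y).add (isPos_dblLeft_siteSpin_mul_zero y x)).smul one_half_nonneg

omit [Fintype Λ] [DecidableEq Λ] in
/-- Regrouping two couplings: `K' L + K R = K (L + R) + (K' − K) L`. [folklore] -/
theorem smul_add_smul_eq (K K' : ℝ) (L R : Op Λ 4) :
    (K' : ℂ) • L + (K : ℂ) • R = (K : ℂ) • (L + R) + ((K' - K : ℝ) : ℂ) • L := by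
  push_cast
  rw [smul_add, sub_smul]
  abel

/-- **The doubled Boltzmann exponent lies in the cone.** For the pair-plus-field XY Hamiltonians
`H = H(K₀,K₁,h₀,h₁)`, `H' = H(K₀',K₁,h₀',h₁)` with `0 ≤ K₀ ≤ K₀'`, `0 ≤ K₁`, `0 ≤ h₀ ≤ h₀'`, `0 ≤ h₁`
and `β ≥ 0`: `(−βH') ⊗ 1 + 1 ⊗ (−βH) = β Σ [K₀ (bond⁰)₊ + (K₀'−K₀)(bond⁰ ⊗ 1) + K₁ (bond¹)₊]
+ β Σ [h₀ (Sˣ)₊ + (h₀'−h₀)(Sˣ ⊗ 1) + h₁ (Sʸ)₊]` is positive. Benassi–Lees–Ueltschi (2016) §3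
(expansion of `(−H_{Λ,+})^k` into positive generators). [cite: BenassiLeesUeltschi2016, §3] -/
theorem isPos_doubledExponent (G : SimpleGraph Λ) [DecidableRel G.Adj] {β : ℝ} (hβ : 0 ≤ β)
    {K₀ K₀' K₁ : Sym2 Λ → ℝ} {h₀ h₀' h₁ : Λ → ℝ}
    (hK₀ : ∀ e, 0 ≤ K₀ e ∧ K₀ e ≤ K₀' e) (hK₁ : ∀ e, 0 ≤ K₁ e)
    (hh₀ : ∀ x, 0 ≤ h₀ x ∧ h₀ x ≤ h₀' x) (hh₁ : ∀ x, 0 ≤ h₁ x) :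
    IsPos (dblLeft (-(β : ℂ) • xyPairFieldHamiltonian G K₀' K₁ h₀' h₁) +
      dblRight (-(β : ℂ) • xyPairFieldHamiltonian G K₀ K₁ h₀ h₁)) := by
  -- the edge and field terms of the two Hamiltonians
  set L' : Sym2 Λ → Op Λ 2 := fun e => Sym2.lift ⟨fun x y =>
      (K₀' e : ℂ) • spinBond 1 0 x y + (K₁ e : ℂ) • spinBond 1 1 x y, fun x y => by simp only [spinBond_comm]⟩ e
    with hL'
  set L : Sym2 Λ → Op Λ 2 := fun e => Sym2.lift ⟨fun x y =>
      (K₀ e : ℂ) • spinBond 1 0 x y + (K₁ e : ℂ) • spinBond 1 1 x y, fun x y => by simp only [spinBond_comm]⟩ e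
    with hL
  set F' : Λ → Op Λ 2 := fun x => (h₀' x : ℂ) • siteSpin 1 x 0 + (h₁ x : ℂ) • siteSpin 1 x 1 with hF'
  set F : Λ → Op Λ 2 := fun x => (h₀ x : ℂ) • siteSpin 1 x 0 + (h₁ x : ℂ) • siteSpin 1 x 1 with hF
  have hH' : xyPairFieldHamiltonian G K₀' K₁ h₀' h₁ = -(∑ e ∈ G.edgeFinset, L' e) - ∑ x, F' x := rfl
  have hH : xyPairFieldHamiltonian G K₀ K₁ h₀ h₁ = -(∑ e ∈ G.edgeFinset, L e) - ∑ x, F x := rfl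
  have key : dblLeft (-(β : ℂ) • xyPairFieldHamiltonian G K₀' K₁ h₀' h₁) +
      dblRight (-(β : ℂ) • xyPairFieldHamiltonian G K₀ K₁ h₀ h₁) =
      (β : ℂ) • (∑ e ∈ G.edgeFinset, (dblLeft (L' e) + dblRight (L e)) +
        ∑ x, (dblLeft (F' x) + dblRight (F x)) : Op Λ 4) := by
    rw [hH', hH, map_smul, map_smul, map_sub, map_sub, map_neg, map_neg, map_sum, map_sum, map_sum,
      map_sum, Finset.sum_add_distrib, Finset.sum_add_distrib, neg_smul, neg_smul, ← smul_neg, ← smul_neg,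
      ← smul_add]
    congr 1
    abel
  rw [key]
  refine IsPos.smul_real (IsPos.add (IsPos.sum _ fun e _ => ?_) (IsPos.sum _ fun x _ => ?_)) hβ
  · induction e using Sym2.ind with
    | h x y =>
      simp only [hL', hL, Sym2.lift_mk, map_add, map_smul]
      have hre : (K₀' s(x, y) : ℂ) • dblLeft (spinBond 1 0 x y) + (K₁ s(x, y) : ℂ) • dblLeft (spinBond 1 1 x y) +
          ((K₀ s(x, y) : ℂ) • dblRight (spinBond 1 0 x y) + (K₁ s(x, y) : ℂ) • dblRight (spinBond 1 1 x y)) =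
          ((K₀' s(x, y) : ℂ) • dblLeft (spinBond 1 0 x y) + (K₀ s(x, y) : ℂ) • dblRight (spinBond 1 0 x y)) +
            (K₁ s(x, y) : ℂ) • opPlus (spinBond 1 1 x y) := by
        unfold opPlus; rw [smul_add]; abel
      rw [hre, smul_add_smul_eq]
      refine IsPos.add (IsPos.add ?_ ?_) ?_
      · exact (isPos_opPlus_spinBond_zero x y).smul_real (hK₀ _).1
      · exact (isPos_dblLeft_spinBond_zero x y).smul_real (sub_nonneg.mpr (hK₀ _).2)
      · exact (isPos_opPlus_spinBond_one x y).smul_real (hK₁ _)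
  · simp only [hF', hF, map_add, map_smul]
    have hre : (h₀' x : ℂ) • dblLeft (siteSpin 1 x 0) + (h₁ x : ℂ) • dblLeft (siteSpin 1 x 1) +
        ((h₀ x : ℂ) • dblRight (siteSpin 1 x 0) + (h₁ x : ℂ) • dblRight (siteSpin 1 x 1)) =
        ((h₀' x : ℂ) • dblLeft (siteSpin 1 x 0) + (h₀ x : ℂ) • dblRight (siteSpin 1 x 0)) +
          (h₁ x : ℂ) • opPlus (siteSpin 1 x 1) := by
      unfold opPlus; rw [smul_add]; abel
    rw [hre, smul_add_smul_eq]
    refine IsPos.add (IsPos.add ?_ ?_) ?_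
    · exact (isPos_opPlus_siteSpin_zero x).smul_real (hh₀ _).1
    · exact (isPos_dblLeft_siteSpin_zero x).smul_real (sub_nonneg.mpr (hh₀ _).2)
    · exact (isPos_opPlus_siteSpin_one x).smul_real (hh₁ _)

/-! ### Assembly -/

/-- The pair-plus-field XY Hamiltonian is Hermitian (real couplings, Hermitian spins).
[cite: BenassiLeesUeltschi2016, §1] -/
theorem xyPairFieldHamiltonian_isHermitian (G : SimpleGraph Λ) [DecidableRel G.Adj]
    (K₀ K₁ : Sym2 Λ → ℝ) (h₀ h₁ : Λ → ℝ) : (xyPairFieldHamiltonian G K₀ K₁ h₀ h₁).IsHermitian := by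
  unfold xyPairFieldHamiltonian
  refine IsHermitian.sub (IsHermitian.neg ?_) ?_
  · rw [IsHermitian, conjTranspose_sum]
    refine Finset.sum_congr rfl fun e _ => ?_
    induction e using Sym2.ind with
    | h x y =>
      simp only [Sym2.lift_mk, conjTranspose_add, conjTranspose_smul, Complex.star_def, conj_ofReal,
        (spinBond_isHermitian 1 0 x y).eq, (spinBond_isHermitian 1 1 x y).eq]
  · rw [IsHermitian, conjTranspose_sum]
    refine Finset.sum_congr rfl fun x _ => ?_
    simp only [conjTranspose_add, conjTranspose_smul, Complex.star_def, conj_ofReal,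
      (siteSpin_isHermitian 1 x 0).eq, (siteSpin_isHermitian 1 x 1).eq]

/-- **Monotonicity from positivity** (route B of the discharge): for Hermitian `H, H'` on
`𝓗_Λ = ⨂_x ℂ²`, if `(−βH') ⊗ 1 + 1 ⊗ (−βH)` and `a₋ = a ⊗ 1 − 1 ⊗ a` lie in the Ginibre cone then
`Re ⟨a⟩_{β,H} ≤ Re ⟨a⟩_{β,H'}`: by Ginibre's identity
`Tr(e^{−βH'}a) Z − Z' Tr(e^{−βH}a) = Tr[e^{(−βH')⊗1+1⊗(−βH)} a₋] ≥ 0` and `Z, Z' > 0`.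
Benassi–Lees–Ueltschi (2016) §3 (proof of Thm. 1) combined with Cor. 2.
[cite: BenassiLeesUeltschi2016, Cor. 2] -/
theorem re_gibbsState_le_of_isPos {β : ℝ} {H H' a : Op Λ 2} (hH : H.IsHermitian) (hH' : H'.IsHermitian)
    (hpos : IsPos (dblLeft (-(β : ℂ) • H') + dblRight (-(β : ℂ) • H))) (ha : IsPos (opMinus a)) :
    (Matrix.gibbsState β H a).re ≤ (Matrix.gibbsState β H' a).re := by
  have hkey := trace_exp_mul_sub_eq_trace_dbl (-(β : ℂ) • H) (-(β : ℂ) • H') a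
  have hnonneg : 0 ≤ ((exp (-(β : ℂ) • H') * a).trace * (exp (-(β : ℂ) • H)).trace -
      (exp (-(β : ℂ) • H')).trace * (exp (-(β : ℂ) • H) * a).trace).re := by
    rw [hkey]
    exact hpos.re_trace_exp_mul_nonneg ha
  have hW : exp (-(β : ℂ) • H) = gibbsWeight β H := rfl
  have hW' : exp (-(β : ℂ) • H') = gibbsWeight β H' := rfl
  have hZ : (gibbsWeight β H).trace = partitionFn β H := rfl
  have hZ' : (gibbsWeight β H').trace = partitionFn β H' := rfl
  rw [hW, hW', hZ, hZ', hH.partitionFn_eq_ofReal β, hH'.partitionFn_eq_ofReal β, sub_re, re_mul_ofReal,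
    re_ofReal_mul] at hnonneg
  rw [hH.re_gibbsState β a, hH'.re_gibbsState β a, inv_mul_eq_div, inv_mul_eq_div,
    div_le_div_iff₀ (hH.sum_exp_pos β) (hH'.sum_exp_pos β)]
  linarith

end GinibreXY

open GinibreXY in
/-- **Benassi–Lees–Ueltschi 2016, Corollary 2 (first inequality), discharged** in the tree's
pair-plus-field, degree-≤-2 form `benassiLeesUeltschi2016_cor2`: raising the direction-`0`
couplings and fields of the spin-½ XY Hamiltonian does not lower `Re⟨Sˣ_x⟩_β` nor
`Re⟨Sˣ_x Sˣ_y⟩_β`. Proof (Ginibre's method as in §3 of the paper, in integrated form — no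
Duhamel derivative): double the system, `Tr(e^{−βH'}a)Z − Z'Tr(e^{−βH}a) = Tr[e^{(−βH')⊗1 + 1⊗(−βH)} a₋]`;
the exponent is a nonnegative combination of `(Sˣ)_±`, `(Sʸ)₊` and pairs `(Sʸ)₋(Sʸ)₋`, all
entrywise nonnegative in the product basis of Lemma 8 (rotated to the `x–y` plane), as is `a₋`;
hence every Taylor term has nonnegative trace. [cite: BenassiLeesUeltschi2016, Cor. 2 (with Thm. 1, Lemmas 7–8)] -/
theorem benassiLeesUeltschi2016_cor2_holds : benassiLeesUeltschi2016_cor2 := by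
  intro Λ _ _ G _ β hβ K₀ K₀' K₁ h₀ h₀' h₁ hK₀ hK₁ hh₀ hh₁ x y
  have hH := xyPairFieldHamiltonian_isHermitian G K₀ K₁ h₀ h₁
  have hH' := xyPairFieldHamiltonian_isHermitian G K₀' K₁ h₀' h₁
  have hpos := isPos_doubledExponent G hβ.le hK₀ hK₁ hh₀ hh₁
  exact ⟨re_gibbsState_le_of_isPos hH hH' hpos (isPos_opMinus_siteSpin_zero x),
    re_gibbsState_le_of_isPos hH hH' hpos (isPos_opMinus_siteSpin_mul_zero x y)⟩

end Literature.MathematicalPhysics.QuantumLattice
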